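import Mathlib
import HarnessLib

/-! # Ribet's end-lattice selection over `ℚ̄_p` (entries form): helper file `…OrientedSteinbergDatumRibetAux`
for stub `stub_orientedSteinbergDatum` of line steinberg-hyperplane (crux ReducibleOrdinaryProModular,
stmt-Langlands-12919)

Let `E ⊆ ℚ̄_p` be a subfield with compact unit ball `{s ∈ E : ‖s‖ ≤ 1}` and a pseudo-uniformizer `ϖ`
(`‖ϖ‖ < 1`, and `‖y‖ < 1 ⇒ ‖y‖ ≤ ‖ϖ‖` on `E`) — e.g. a finite extension of `ℚ_p` — and let
`M_i = (a_i b_i; c_i d_i)`, `i ∈ ι`, be a family of `E`-rational integral matrices which are upper triangular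
modulo the maximal ideal (`‖c_i‖ < 1`).  Conjugating by `T = (1 s; 0 ϖⁿ)` replaces `M` by
`T M T⁻¹ = (a + s c, (b + s (d - a) - s² c)/ϖⁿ; ϖⁿ c, d - s c)`, which is integral iff
`‖b_i + s (d_i - a_i) - s² c_i‖ ≤ ‖ϖ‖ⁿ` for all `i` (the lattice `⟨e₀, ϖ⁻ⁿ(e₁ - s e₀)⟩` is stable).

* `ribet_selection` (REGISTERED as `stub_orientedSteinbergDatum_auxRibetSelection`): if no line `⟨e₁ - s e₀⟩` is stable (irreducibility), there is a
  LAST such lattice: `(n, s)` integral while NO `(n + 1, s')` is — Ribet's "moving down the tree until the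
  reduction becomes non-split" made effective by compactness of the unit ball of `E` (Cantor intersection)
  instead of his finiteness count.
* `endLattice_nonsplit`: at the last lattice the reduction `(ā' b̄'; 0 d̄')` is NON-SPLIT: no integral `x ∈ E`
  has `b̄' = x̄ (d̄' - ā')` (else `(n + 1, s - ϖⁿ x)` would again be integral).
* `endLattice_norms`: the new entries are integral, `c'` and `a' - a`, `d' - d` lie in the maximal ideal
  (same ordered residual diagonal).
* `endLattice_eigenline`: an integral eigenvector `(u, 1)` of the family (an "oriented ordinary line":
  its reduction is not `ē₀`) stays oriented in the end lattice: `x = (u + s)/ϖⁿ` is integral and `(x, 1)` is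
  an eigenvector of `T M T⁻¹`, with distinct residual eigenvalue and co-eigenvalue wherever `‖a - d‖ = 1`.
* `exists_conjugator`: the matrix `T` as an element of `GL₂` with the displayed conjugation formula.

References: K. Ribet, *A modular construction of unramified p-extensions of ℚ(μ_p)*, Invent. Math. 34 (1976),
Prop. 2.1; J. Bellaïche, G. Chenevier, Astérisque 324 (2009), §1.7 (trees and end lattices); C. Skinner,
A. Wiles, Publ. Math. IHÉS 89 (1999), §2.1 and §4.6 (the oriented admissible lattice).
-/

set_option linter.dupNamespace false
set_option autoImplicit false

namespace Summit.Langlands.Langlands.Cruxes.ReducibleOrdinaryProModular.SteinbergHyperplane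

open scoped MatrixGroups
open Matrix

noncomputable section

namespace OrientedDatum

variable {p : ℕ} [Fact p.Prime]

/-- Ultrametric inequality for differences in `ℚ̄_p`. [folklore] -/
theorem norm_sub_le_max' (x y : PadicAlgCl p) : ‖x - y‖ ≤ max ‖x‖ ‖y‖ := by
  rw [sub_eq_add_neg, ← norm_neg y]
  exact IsUltrametricDist.norm_add_le_max x (-y)

/-- Ultrametric inequality for sums in `ℚ̄_p` with a common bound. [folklore] -/
theorem norm_add_le_of_le' {x y : PadicAlgCl p} {C : ℝ} (hx : ‖x‖ ≤ C) (hy : ‖y‖ ≤ C) : ‖x + y‖ ≤ C :=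
  (IsUltrametricDist.norm_add_le_max x y).trans (max_le hx hy)

/-- Ultrametric inequality for differences in `ℚ̄_p` with a common bound. [folklore] -/
theorem norm_sub_le_of_le' {x y : PadicAlgCl p} {C : ℝ} (hx : ‖x‖ ≤ C) (hy : ‖y‖ ≤ C) : ‖x - y‖ ≤ C :=
  (norm_sub_le_max' x y).trans (max_le hx hy)

/-- In `ℚ̄_p`: if `‖y‖ < 1 ≤ ‖x‖` then `1 ≤ ‖x + y‖` (all triangles are isosceles). [folklore] -/
theorem one_le_norm_add_of_lt' {x y : PadicAlgCl p} (hx : 1 ≤ ‖x‖) (hy : ‖y‖ < 1) : 1 ≤ ‖x + y‖ := by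
  by_contra h
  have h1 : ‖x‖ < 1 := by
    have := norm_sub_le_max' (x + y) y
    rw [add_sub_cancel_right] at this
    exact this.trans_lt (max_lt (not_le.1 h) hy)
  exact absurd hx (not_le.2 h1)

/-- **Ribet's end-lattice selection** (effective form over `ℚ̄_p`).  For a family of matrices
`(a_i b_i; c_i d_i)` with `‖b_i‖ ≤ 1` and no common eigenline `⟨e₁ - s e₀⟩` with `s` in the unit ball of `E`,
there is a last pair `(n, s)`: `‖b_i + s (d_i - a_i) - s² c_i‖ ≤ ‖ϖ‖ⁿ` for all `i`, while every `s'` in the unit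
ball of `E` violates the bound `‖ϖ‖ⁿ⁺¹` at some `i`. [cite: Ribet1976, Prop. 2.1] -/
theorem ribet_selection (E : IntermediateField ℚ_[p] (PadicAlgCl p)) (ϖ : PadicAlgCl p)
    (hcpt : IsCompact {s : PadicAlgCl p | s ∈ E ∧ ‖s‖ ≤ 1}) (hϖ : ‖ϖ‖ < 1)
    {ι : Type} (a b c d : ι → PadicAlgCl p) (hb : ∀ i, ‖b i‖ ≤ 1)
    (hirr : ∀ s : PadicAlgCl p, s ∈ E → ‖s‖ ≤ 1 →
      (∀ i, b i + s * (d i - a i) - s ^ 2 * c i = 0) → False) :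
    ∃ (n : ℕ) (s : PadicAlgCl p), s ∈ E ∧ ‖s‖ ≤ 1 ∧
      (∀ i, ‖b i + s * (d i - a i) - s ^ 2 * c i‖ ≤ ‖ϖ‖ ^ n) ∧
      ∀ s' : PadicAlgCl p, s' ∈ E → ‖s'‖ ≤ 1 →
        ∃ i, ‖ϖ‖ ^ (n + 1) < ‖b i + s' * (d i - a i) - s' ^ 2 * c i‖ := by
  classical
  set f : ι → PadicAlgCl p → PadicAlgCl p := fun i s => b i + s * (d i - a i) - s ^ 2 * c i with hf
  set S : ℕ → Set (PadicAlgCl p) :=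
    fun n => {s | s ∈ E ∧ ‖s‖ ≤ 1 ∧ ∀ i, ‖f i s‖ ≤ ‖ϖ‖ ^ n} with hS
  have hanti : ∀ n, S (n + 1) ⊆ S n := fun n s hs =>
    ⟨hs.1, hs.2.1, fun i => (hs.2.2 i).trans
      (pow_le_pow_of_le_one (norm_nonneg _) hϖ.le (Nat.le_succ n))⟩
  have hclosed : ∀ n, IsClosed (S n) := by
    intro n
    have h1 : S n = {s | s ∈ E ∧ ‖s‖ ≤ 1} ∩ ⋂ i, {s | ‖f i s‖ ≤ ‖ϖ‖ ^ n} := by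
      ext s
      simp only [hS, Set.mem_setOf_eq, Set.mem_inter_iff, Set.mem_iInter]
      tauto
    rw [h1]
    refine hcpt.isClosed.inter (isClosed_iInter fun i => ?_)
    exact isClosed_le (continuous_norm.comp (by simp only [hf]; fun_prop)) continuous_const
  have h0 : (0 : PadicAlgCl p) ∈ S 0 :=
    ⟨zero_mem E, by simp, fun i => by simp [hf, hb i]⟩
  have hempty : ∃ n, S n = ∅ := by
    by_contra hne
    push Not at hne
    have hne' : ∀ n, (S n).Nonempty := hne
    obtain ⟨s, hs⟩ := IsCompact.nonempty_iInter_of_sequence_nonempty_isCompact_isClosed S hanti hne'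
      (hcpt.of_isClosed_subset (hclosed 0) fun s hs => ⟨hs.1, hs.2.1⟩) hclosed
    have hs' := Set.mem_iInter.1 hs
    refine hirr s (hs' 0).1 (hs' 0).2.1 fun i => ?_
    by_contra hfi
    obtain ⟨n, hn⟩ := exists_pow_lt_of_lt_one (norm_pos_iff.2 hfi) hϖ
    exact absurd ((hs' n).2.2 i) (not_le.2 hn)
  obtain ⟨m, hm, hmin⟩ : ∃ m, S m = ∅ ∧ ∀ k < m, S k ≠ ∅ :=
    ⟨Nat.find hempty, Nat.find_spec hempty, fun k hk => Nat.find_min hempty hk⟩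
  have hm0 : m ≠ 0 := by
    rintro rfl
    rw [Set.eq_empty_iff_forall_notMem] at hm
    exact hm 0 h0
  obtain ⟨n, rfl⟩ := Nat.exists_eq_succ_of_ne_zero hm0
  obtain ⟨s, hsE, hs1, hsf⟩ := Set.nonempty_iff_ne_empty.2 (hmin n (Nat.lt_succ_self n))
  refine ⟨n, s, hsE, hs1, hsf, fun s' hs'E hs'1 => ?_⟩
  by_contra hcon
  push Not at hcon
  have hmem : s' ∈ S (n + 1) := ⟨hs'E, hs'1, hcon⟩
  exact (Set.eq_empty_iff_forall_notMem.1 hm) s' hmem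

/-- **The conjugating matrix `T = (1 s; 0 t)`** (`t ≠ 0`) as an element of `GL₂`, with the conjugation
formula `T M T⁻¹ = (a + s c, (b + s (d - a) - s² c)/t; t c, d - s c)`. [folklore] -/
theorem exists_conjugator {K : Type*} [Field K] (s t : K) (ht : t ≠ 0) :
    ∃ T : GL (Fin 2) K, T.val = !![1, s; 0, t] ∧ (T⁻¹).val = !![1, -s / t; 0, 1 / t] ∧
      ∀ M : Matrix (Fin 2) (Fin 2) K, T.val * M * (T⁻¹).val =
        !![M 0 0 + s * M 1 0, (M 0 1 + s * (M 1 1 - M 0 0) - s ^ 2 * M 1 0) / t;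
           t * M 1 0, M 1 1 - s * M 1 0] := by
  have h1 : !![(1 : K), s; 0, t] * !![1, -s / t; 0, 1 / t] = 1 := by
    rw [Matrix.mul_fin_two, Matrix.one_fin_two]
    simp [ht]
    ring
  have h2 : !![1, -s / t; 0, 1 / t] * !![(1 : K), s; 0, t] = 1 := by
    rw [Matrix.mul_fin_two, Matrix.one_fin_two]
    simp [ht]
  refine ⟨⟨_, _, h1, h2⟩, rfl, rfl, fun M => ?_⟩
  change !![(1 : K), s; 0, t] * M * !![1, -s / t; 0, 1 / t] = _
  rw [Matrix.eta_fin_two M, Matrix.mul_fin_two, Matrix.mul_fin_two]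
  ext i j
  fin_cases i <;> fin_cases j
  · simp
  · simp
    field_simp
    ring
  · simp
  · simp
    field_simp
    ring

/-- **Integrality and residual shape of the end lattice.**  With `‖a‖, ‖b‖, ‖d‖ ≤ 1`, `‖c‖ < 1`, `‖s‖ ≤ 1`,
`‖t‖ ≤ 1` and `‖b + s (d - a) - s² c‖ ≤ ‖t‖`, the entries of `T M T⁻¹` are integral, its lower-left entry and
the differences of the diagonal entries with those of `M` have norm `< 1`. [folklore] -/
theorem endLattice_norms {a b c d s t : PadicAlgCl p} (ha : ‖a‖ ≤ 1) (hd : ‖d‖ ≤ 1)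
    (hc : ‖c‖ < 1) (hs : ‖s‖ ≤ 1) (ht1 : ‖t‖ ≤ 1)
    (hf : ‖b + s * (d - a) - s ^ 2 * c‖ ≤ ‖t‖) :
    ‖a + s * c‖ ≤ 1 ∧ ‖(b + s * (d - a) - s ^ 2 * c) / t‖ ≤ 1 ∧ ‖t * c‖ < 1 ∧ ‖d - s * c‖ ≤ 1 ∧
      ‖(a + s * c) - a‖ < 1 ∧ ‖(d - s * c) - d‖ < 1 := by
  have hsc : ‖s * c‖ < 1 := by
    rw [norm_mul]
    exact mul_lt_one_of_nonneg_of_lt_one_right hs (norm_nonneg _) hc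
  refine ⟨norm_add_le_of_le' ha hsc.le, ?_, ?_, norm_sub_le_of_le' hd hsc.le, ?_, ?_⟩
  · rw [norm_div]
    exact div_le_one_of_le₀ hf (norm_nonneg _)
  · rw [norm_mul]
    exact mul_lt_one_of_nonneg_of_lt_one_right ht1 (norm_nonneg _) hc
  · rwa [add_sub_cancel_left]
  · rwa [sub_sub_cancel_left, norm_neg]

/-- **The end lattice has NON-SPLIT reduction.**  At the last pair `(n, s)` of `ribet_selection`, no integral
`x ∈ E` satisfies `b̄' = x̄ (d̄' - ā')` for the whole family `T Mᵢ T⁻¹ = (a' b'; c' d')`, `T = (1 s; 0 ϖⁿ)`: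
otherwise `(n + 1, s - ϖⁿ x)` would be integral.  (Residually: the class of `b̄'` in `H¹` is non-zero.)
[cite: Ribet1976, Prop. 2.1] -/
theorem endLattice_nonsplit (E : IntermediateField ℚ_[p] (PadicAlgCl p)) (ϖ : PadicAlgCl p)
    (hϖE : ϖ ∈ E) (hϖ0 : ϖ ≠ 0) (hϖ1 : ‖ϖ‖ ≤ 1)
    (hdisc : ∀ y : PadicAlgCl p, y ∈ E → ‖y‖ < 1 → ‖y‖ ≤ ‖ϖ‖)
    {ι : Type} (a b c d : ι → PadicAlgCl p)
    (hE : ∀ i, a i ∈ E ∧ b i ∈ E ∧ c i ∈ E ∧ d i ∈ E) (hc : ∀ i, ‖c i‖ < 1)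
    (n : ℕ) (s : PadicAlgCl p) (hsE : s ∈ E) (hs1 : ‖s‖ ≤ 1)
    (hmax : ∀ s' : PadicAlgCl p, s' ∈ E → ‖s'‖ ≤ 1 →
      ∃ i, ‖ϖ‖ ^ (n + 1) < ‖b i + s' * (d i - a i) - s' ^ 2 * c i‖)
    (x : PadicAlgCl p) (hxE : x ∈ E) (hx1 : ‖x‖ ≤ 1) :
    ∃ i, 1 ≤ ‖(b i + s * (d i - a i) - s ^ 2 * c i) / ϖ ^ n -
      x * ((d i - s * c i) - (a i + s * c i))‖ := by
  by_contra hcon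
  push Not at hcon
  have htn : (ϖ ^ n : PadicAlgCl p) ≠ 0 := pow_ne_zero _ hϖ0
  set s' : PadicAlgCl p := s - ϖ ^ n * x with hs'
  have hs'E : s' ∈ E := sub_mem hsE (mul_mem (pow_mem hϖE n) hxE)
  have hs'1 : ‖s'‖ ≤ 1 := by
    refine norm_sub_le_of_le' hs1 ?_
    rw [norm_mul, norm_pow]
    exact mul_le_one₀ (pow_le_one₀ (norm_nonneg _) hϖ1) (norm_nonneg _) hx1
  obtain ⟨i, hi⟩ := hmax s' hs'E hs'1
  obtain ⟨haE, hbE, hcE, hdE⟩ := hE i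
  -- the key identity
  have hid : b i + s' * (d i - a i) - s' ^ 2 * c i =
      ϖ ^ n * ((b i + s * (d i - a i) - s ^ 2 * c i) / ϖ ^ n -
        x * ((d i - s * c i) - (a i + s * c i))) - (ϖ ^ n) ^ 2 * x ^ 2 * c i := by
    rw [hs']
    field_simp
    ring
  have hy1 : ‖(b i + s * (d i - a i) - s ^ 2 * c i) / ϖ ^ n -
      x * ((d i - s * c i) - (a i + s * c i))‖ ≤ ‖ϖ‖ := by
    refine hdisc _ ?_ (hcon i)
    exact sub_mem (div_mem (sub_mem (add_mem hbE (mul_mem hsE (sub_mem hdE haE)))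
      (mul_mem (pow_mem hsE 2) hcE)) (pow_mem hϖE n))
      (mul_mem hxE (sub_mem (sub_mem hdE (mul_mem hsE hcE)) (add_mem haE (mul_mem hsE hcE))))
  have hci : ‖c i‖ ≤ ‖ϖ‖ := hdisc _ hcE (hc i)
  have hle : ‖b i + s' * (d i - a i) - s' ^ 2 * c i‖ ≤ ‖ϖ‖ ^ (n + 1) := by
    rw [hid]
    refine norm_sub_le_of_le' ?_ ?_
    · rw [norm_mul, norm_pow, pow_succ ‖ϖ‖ n]
      exact mul_le_mul_of_nonneg_left hy1 (pow_nonneg (norm_nonneg _) _)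
    · rw [norm_mul, norm_mul, norm_pow, norm_pow, norm_pow]
      have hϖn : 0 ≤ ‖ϖ‖ ^ n := pow_nonneg (norm_nonneg _) _
      have h1 : (‖ϖ‖ ^ n) ^ 2 ≤ ‖ϖ‖ ^ n :=
        pow_le_of_le_one hϖn (pow_le_one₀ (norm_nonneg _) hϖ1) two_ne_zero
      have h2 : ‖x‖ ^ 2 ≤ 1 := pow_le_one₀ (norm_nonneg _) hx1
      calc (‖ϖ‖ ^ n) ^ 2 * ‖x‖ ^ 2 * ‖c i‖ ≤ ‖ϖ‖ ^ n * 1 * ‖ϖ‖ :=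
            mul_le_mul (mul_le_mul h1 h2 (by positivity) hϖn) hci (norm_nonneg _) (by positivity)
        _ = ‖ϖ‖ ^ (n + 1) := by ring
  exact absurd hle (not_le.2 hi)

/-- **The oriented eigenline survives in the end lattice.**  If `(u, 1)` with `‖u‖ ≤ 1` is a common eigenvector
of an integral family `(a b; c d)` with `‖c‖ < 1` (so its eigenvalue `c u + d` is residually the LOWER diagonal
character) and the family is residually distinguished somewhere (`1 ≤ ‖a - d‖`), then for `T = (1 s; 0 ϖⁿ)` with
`T M T⁻¹` integral, `x = (u + s)/ϖⁿ` is integral, `(x, 1)` is a common eigenvector of `T M T⁻¹ = (a' b'; c' d')`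
(i.e. `a' x + b' = x (c' x + d')`), and the frame `(x 1; 1 0)` is residually distinguished where `M` is.
[cite: SkinnerWiles1999, §4.6] -/
theorem endLattice_eigenline (ϖ : PadicAlgCl p) (hϖ0 : ϖ ≠ 0) (hϖ1 : ‖ϖ‖ ≤ 1)
    {Δ : Type} (a b c d : Δ → PadicAlgCl p) (hc : ∀ δ, ‖c δ‖ < 1)
    (n : ℕ) (s : PadicAlgCl p) (hs1 : ‖s‖ ≤ 1)
    (hfs : ∀ δ, ‖b δ + s * (d δ - a δ) - s ^ 2 * c δ‖ ≤ ‖ϖ‖ ^ n)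
    (u : PadicAlgCl p) (hu1 : ‖u‖ ≤ 1) (heig : ∀ δ, a δ * u + b δ = (c δ * u + d δ) * u)
    (hdist : ∃ δ₀, 1 ≤ ‖a δ₀ - d δ₀‖) :
    ‖(u + s) / ϖ ^ n‖ ≤ 1 ∧
      (∀ δ, (a δ + s * c δ) * ((u + s) / ϖ ^ n) + (b δ + s * (d δ - a δ) - s ^ 2 * c δ) / ϖ ^ n =
        ((u + s) / ϖ ^ n) * ((ϖ ^ n * c δ) * ((u + s) / ϖ ^ n) + (d δ - s * c δ))) ∧
      ∃ δ₀, 1 ≤ ‖((ϖ ^ n * c δ₀) * ((u + s) / ϖ ^ n) + (d δ₀ - s * c δ₀)) -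
        ((a δ₀ + s * c δ₀) - ((u + s) / ϖ ^ n) * (ϖ ^ n * c δ₀))‖ := by
  have htn : (ϖ ^ n : PadicAlgCl p) ≠ 0 := pow_ne_zero _ hϖ0
  set t : PadicAlgCl p := ϖ ^ n with ht
  -- eigen-equations for the vector `(u + s, t) = T (u, 1)`
  have hw1 : ∀ δ, (a δ + s * c δ) * (u + s) + (b δ + s * (d δ - a δ) - s ^ 2 * c δ) =
      (c δ * u + d δ) * (u + s) := fun δ => by linear_combination (heig δ)
  -- `1 ≤ ‖a' - θ‖` at a distinguished index
  have hkey : ∀ δ, 1 ≤ ‖a δ - d δ‖ → 1 ≤ ‖(a δ + s * c δ) - (c δ * u + d δ)‖ := by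
    intro δ hδ
    have he : (a δ + s * c δ) - (c δ * u + d δ) = (a δ - d δ) + (s * c δ - c δ * u) := by ring
    rw [he]
    refine one_le_norm_add_of_lt' hδ ?_
    refine (norm_sub_le_of_le' (C := ‖c δ‖) ?_ ?_).trans_lt (hc δ)
    · rw [norm_mul]; exact mul_le_of_le_one_left (norm_nonneg _) hs1
    · rw [norm_mul]; exact mul_le_of_le_one_right (norm_nonneg _) hu1
  -- `‖u + s‖ ≤ ‖t‖`
  obtain ⟨δ₀, hδ₀⟩ := hdist
  have hus : ‖u + s‖ ≤ ‖t‖ := by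
    have h1 : ((a δ₀ + s * c δ₀) - (c δ₀ * u + d δ₀)) * (u + s) =
        -(b δ₀ + s * (d δ₀ - a δ₀) - s ^ 2 * c δ₀) := by linear_combination (hw1 δ₀)
    have h2 : ‖(a δ₀ + s * c δ₀) - (c δ₀ * u + d δ₀)‖ * ‖u + s‖ ≤ ‖t‖ := by
      rw [← norm_mul, h1, norm_neg, ht, norm_pow]; exact hfs δ₀
    calc ‖u + s‖ = 1 * ‖u + s‖ := (one_mul _).symm
      _ ≤ ‖(a δ₀ + s * c δ₀) - (c δ₀ * u + d δ₀)‖ * ‖u + s‖ :=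
          mul_le_mul_of_nonneg_right (hkey δ₀ hδ₀) (norm_nonneg _)
      _ ≤ ‖t‖ := h2
  have hx1 : ‖(u + s) / t‖ ≤ 1 := by
    rw [norm_div]; exact div_le_one_of_le₀ hus (norm_nonneg _)
  refine ⟨hx1, fun δ => ?_, δ₀, ?_⟩
  · have key : (a δ + s * c δ) * ((u + s) / t) + (b δ + s * (d δ - a δ) - s ^ 2 * c δ) / t -
        ((u + s) / t) * ((t * c δ) * ((u + s) / t) + (d δ - s * c δ)) =
        ((a δ + s * c δ) * (u + s) + (b δ + s * (d δ - a δ) - s ^ 2 * c δ) -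
          (c δ * u + d δ) * (u + s)) / t := by
      field_simp
      ring
    have hz : (a δ + s * c δ) * (u + s) + (b δ + s * (d δ - a δ) - s ^ 2 * c δ) -
        (c δ * u + d δ) * (u + s) = 0 := by rw [hw1 δ, sub_self]
    rw [hz, zero_div] at key
    exact sub_eq_zero.1 key
  · have he : (t * c δ₀) * ((u + s) / t) + (d δ₀ - s * c δ₀) - ((a δ₀ + s * c δ₀) - ((u + s) / t) * (t * c δ₀)) =
        -((a δ₀ + s * c δ₀) - (c δ₀ * u + d δ₀)) + ((u + s) / t) * (t * c δ₀) := by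
      field_simp
      ring
    rw [he]
    refine one_le_norm_add_of_lt' (by rw [norm_neg]; exact hkey δ₀ hδ₀) ?_
    rw [norm_mul]
    refine (mul_le_of_le_one_left (norm_nonneg _) hx1).trans_lt ?_
    rw [norm_mul, ht, norm_pow]
    exact mul_lt_one_of_nonneg_of_lt_one_right (pow_le_one₀ (norm_nonneg _) hϖ1) (norm_nonneg _) (hc δ₀)

end OrientedDatum

/-- **Registered sub-goal of `stub_orientedSteinbergDatum` (auxiliary file I): Ribet's end-lattice selection**
over `ℚ̄_p` in entries form (= `OrientedDatum.ribet_selection` with explicit binders). [cite: Ribet1976, Prop. 2.1] -/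
theorem stub_orientedSteinbergDatum_auxRibetSelection :
    ∀ (p : ℕ) [Fact p.Prime] (E : IntermediateField ℚ_[p] (PadicAlgCl p)) (ϖ : PadicAlgCl p), IsCompact {s : PadicAlgCl p | s ∈ E ∧ ‖s‖ ≤ 1} → ‖ϖ‖ < 1 → ∀ (ι : Type) (a b c d : ι → PadicAlgCl p), (∀ i, ‖b i‖ ≤ 1) → (∀ s : PadicAlgCl p, s ∈ E → ‖s‖ ≤ 1 → (∀ i, b i + s * (d i - a i) - s ^ 2 * c i = 0) → False) → ∃ (n : ℕ) (s : PadicAlgCl p), s ∈ E ∧ ‖s‖ ≤ 1 ∧ (∀ i, ‖b i + s * (d i - a i) - s ^ 2 * c i‖ ≤ ‖ϖ‖ ^ n) ∧ ∀ s' : PadicAlgCl p, s' ∈ E → ‖s'‖ ≤ 1 → ∃ i, ‖ϖ‖ ^ (n + 1) < ‖b i + s' * (d i - a i) - s' ^ 2 * c i‖ :=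
  fun _ _ E ϖ hcpt hϖ _ a b c d hb hirr => OrientedDatum.ribet_selection E ϖ hcpt hϖ a b c d hb hirr

end

end Summit.Langlands.Langlands.Cruxes.ReducibleOrdinaryProModular.SteinbergHyperplane
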